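import Mathlib
import HarnessLib
import Summits.ResolutionOfSingularities.ResolutionOfSingularities.Theorems.WildQuotientsWildQuotientResolutionJordanFiveChart0Seam

/-!
# RUNG V5 (`J₅`), β‴ `HP₀` glue: the chart-0 seam in ring-brick letters and the two-locus
# transport `ringBrick_transport₂`
(crux stmt-ResolutionOfSingularities-15640 `WildQuotients.WildQuotientResolution`, line `Sketch`;
chain w45c RUNG V5 `HP₀` variant β‴ — res-L1-w45c-plan-1 ORDER 13:38:34Z (1)+(2) to res-D-pv-033 AS
res-L1-w45c-stub-5; the H₀′ ring-brick SIG of res-L1-w45c-lead-1 13:38:09Z (`coneBrick_zero_of_ringBrick'`,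
letters of p531258 `coneBrick_zero_of_ringBrick₂`: `u := x_a³ = gens12 0`, `V := chart 0`, `hle`,
ratios `T` over `{j ∉ {0,2,5,13}}` and `T'` over `{j ≠ 0}`). [OURS · L1 W4.5c] — assembly of landed
decls; NOT a statement of any manuscript.)

* `BlowupExit.ringBrick_transport₂` — the J-free two-locus twin of `JordanFour.ringBrick_transport`
  (p519150): along a sections isomorphism `Ω : B ≃+* C` with (i′) and (iii), a RING-SIDE brick
  «for all ratio families `t, t'`: `∃ R₀` Noetherian, radical `J₀, J₀'`, injective `ψC` onto the
  `φ`-fixed part, the two radical identities, `Bl_{J₀·(J₀²:J₀')}` regular» becomes the SCHEME-SIDE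
  brick with `ψ := Ω ∘ ψC`, `t_j := Ω⁻¹(r (T j))` — conclusion in the order of the H₀′ SIG;
* `JordanFive.exists_sectionsEquiv_chart0_appLE` — the chart-0 seam p530904 with clause (i) as
  (i′) `O₀.1.ι.appLE (chart 0) _ hle (π.appLE ⊤ (chart 0) _ (ι₀ f)) = Ω (f/1)`.
With these, `brickHP0'` (assembler res-L1-w45c-stub-4) := seam₀-appLE ∘ transport₂ ∘ (stub-2's
`exists_ringBrick_X0_model` ⊕ stub-4's `Quarter1123.blowup_regular_mulColon`).
-/

-- single-problem summit: the doubled namespace component `ResolutionOfSingularities` is forced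
set_option linter.dupNamespace false

noncomputable section

open CategoryTheory AlgebraicGeometry TopologicalSpace MvPolynomial Polynomial HomogeneousLocalization
open Literature.AlgebraicGeometry.Resolution Literature.AlgebraicGeometry.RelativeSpec
open scoped Pointwise

namespace Summit.ResolutionOfSingularities.ResolutionOfSingularities.Theorems.WildQuotientResolution

namespace BlowupExit

/-- **Two-locus transport of a ring brick along a sections isomorphism `Ω : B ≃+* C`** (J-free;
small types only, as `JordanFour.ringBrick_transport`): `ι0 : S → Γ₀`, `πapp : Γ₀ → Γ₁` stand for
`ι₀` and `π^*|_V`, `r : Γ₁ →+* C` for the restriction to `O`, `base : S → B` for `f ↦ f/1`, `Inv`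
for the invariants, `P` for «fixed by every `φ_g`»; two ratio families `T, T'` (equations `F`).
The extra fields (`IsNoetherianRing R₀`, `J₀, J₀'` radical, `Bl_{J₀·(J₀²:J₀')}` regular) are carried
through unchanged. [folklore; bookkeeping] -/
theorem ringBrick_transport₂ {S Γ₀ Γ₁ B C : Type} [CommRing Γ₁] [CommRing B] [CommRing C]
    {ι ι' : Type} (ι0 : S → Γ₀) (πapp : Γ₀ → Γ₁) (r : Γ₁ →+* C) (base : S → B) (Ω : B ≃+* C)
    (hbase : ∀ f, r (πapp (ι0 f)) = Ω (base f))
    (Inv : Subring C) (P : B → Prop) (hinv : ∀ y, Ω y ∈ Inv ↔ P y)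
    (u : S) (gen : ι → S) (gen' : ι' → S) (F : Set S) (T : ι → Γ₁) (T' : ι' → Γ₁)
    (hT : ∀ j, πapp (ι0 (gen j)) = πapp (ι0 u) * T j)
    (hT' : ∀ j, πapp (ι0 (gen' j)) = πapp (ι0 u) * T' j)
    (H : ∀ (t : ι → B) (t' : ι' → B), (∀ j, base u * t j = base (gen j)) →
      (∀ j, base u * t' j = base (gen' j)) →
      ∃ (R₀ : Type) (_ : CommRing R₀) (_ : IsNoetherianRing R₀) (J₀ J₀' : Ideal R₀) (ψC : R₀ →+* B),
        Function.Injective ψC ∧ (∀ y : B, y ∈ Set.range ψC ↔ P y) ∧ J₀.IsRadical ∧ J₀'.IsRadical ∧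
        ((Ideal.span (base '' F ∪ Set.range t)).comap ψC).radical = J₀ ∧
        ((Ideal.span (base '' F ∪ Set.range t')).comap ψC).radical = J₀' ∧
        Scheme.IsRegular (affineBlowup (J₀ * (J₀ ^ 2).colon (J₀' : Set R₀)))) :
    ∃ (R₀ : Type) (_ : CommRing R₀) (_ : IsNoetherianRing R₀) (J₀ J₀' : Ideal R₀) (ψ : R₀ →+* C),
      Function.Injective ψ ∧ ψ.range = Inv ∧ J₀.IsRadical ∧ J₀'.IsRadical ∧
      ((Ideal.span (r '' (πapp '' (ι0 '' F) ∪ Set.range T))).comap ψ).radical = J₀ ∧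
      ((Ideal.span (r '' (πapp '' (ι0 '' F) ∪ Set.range T'))).comap ψ).radical = J₀' ∧
      Scheme.IsRegular (affineBlowup (J₀ * (J₀ ^ 2).colon (J₀' : Set R₀))) := by
  -- the base elements and the ratios read in `B`
  have hfun : ∀ f, Ω.symm (r (πapp (ι0 f))) = base f := fun f => by
    rw [hbase, RingEquiv.symm_apply_apply]
  have ht : ∀ j, base u * Ω.symm (r (T j)) = base (gen j) := by
    intro j
    apply Ω.injective
    rw [map_mul, RingEquiv.apply_symm_apply, ← hbase, ← hbase, hT, map_mul]
  have ht' : ∀ j, base u * Ω.symm (r (T' j)) = base (gen' j) := by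
    intro j
    apply Ω.injective
    rw [map_mul, RingEquiv.apply_symm_apply, ← hbase, ← hbase, hT', map_mul]
  obtain ⟨R₀, _, _, J₀, J₀', ψC, hinj, hrange, hrad, hrad', hJ, hJ', hreg⟩ :=
    H (fun j => Ω.symm (r (T j))) (fun j => Ω.symm (r (T' j))) ht ht'
  -- pulling a generating set back along `Ω`
  have hpull : ∀ (T₀ : Set Γ₁) (t₀ : Set B), Ω.symm '' (r '' T₀) = t₀ →
      (Ideal.span (r '' (πapp '' (ι0 '' F) ∪ T₀))).comap (Ω.toRingHom.comp ψC) =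
        (Ideal.span (base '' F ∪ t₀)).comap ψC := by
    intro T₀ t₀ h
    have hset : Ω.symm '' (r '' (πapp '' (ι0 '' F) ∪ T₀)) = base '' F ∪ t₀ := by
      rw [Set.image_union, Set.image_union, h]
      simp only [Set.image_image, hfun]
    rw [← Ideal.comap_comap, RingEquiv.toRingHom_eq_coe, Ideal.comap_coe, ← Ideal.map_symm,
      Ideal.map_span, hset]
  have hTset : Ω.symm '' (r '' Set.range T) = Set.range (fun j => Ω.symm (r (T j))) := by
    rw [← Set.range_comp, ← Set.range_comp]; rfl
  have hT'set : Ω.symm '' (r '' Set.range T') = Set.range (fun j => Ω.symm (r (T' j))) := by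
    rw [← Set.range_comp, ← Set.range_comp]; rfl
  refine ⟨R₀, inferInstance, inferInstance, J₀, J₀', Ω.toRingHom.comp ψC, Ω.injective.comp hinj,
    ?_, hrad, hrad', ?_, ?_, hreg⟩
  · -- range = invariants, by (iii)
    ext y
    rw [RingHom.mem_range]
    constructor
    · rintro ⟨x, rfl⟩
      rw [RingHom.comp_apply, RingEquiv.toRingHom_eq_coe, RingHom.coe_coe]
      exact (hinv (ψC x)).2 ((hrange (ψC x)).1 ⟨x, rfl⟩)
    · intro hy
      have hy' : P (Ω.symm y) := (hinv (Ω.symm y)).1 (by rwa [RingEquiv.apply_symm_apply])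
      obtain ⟨x, hx⟩ := (hrange (Ω.symm y)).2 hy'
      refine ⟨x, ?_⟩
      rw [RingHom.comp_apply, RingEquiv.toRingHom_eq_coe, RingHom.coe_coe, hx,
        RingEquiv.apply_symm_apply]
  · rw [hpull _ _ hTset]; exact hJ
  · rw [hpull _ _ hT'set]; exact hJ'

end BlowupExit

namespace JordanFive

variable (k : Type) [Field k] (n : ℕ) (σ : MvPolynomial (Fin n) k ≃ₐ[k] MvPolynomial (Fin n) k)
  (a b c d e : Fin n) (hab : a ≠ b) (hac : a ≠ c) (had : a ≠ d) (hae : a ≠ e)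
  (hσ : ∀ i, i ≠ b → i ≠ c → i ≠ d → i ≠ e → σ (X i) = X i)

/-- `k[x] → Γ(Spec k[x], ⊤)` (local shorthand) -/
local notation3 "ι₀" => (Scheme.ΓSpecIso (CommRingCat.of (MvPolynomial (Fin n) k))).inv.hom
/-- the quotient map `q : 𝔸ⁿ → 𝔸ⁿ/⟨σ⟩` (local shorthand) -/
local notation3 "qσ" => Spec.map (CommRingCat.ofHom (algebraMap
  (FixedPoints.subalgebra k (MvPolynomial (Fin n) k) (Subgroup.zpowers σ)) (MvPolynomial (Fin n) k)))

include hab hac had hae hσ in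
-- large literal binders
set_option maxHeartbeats 4000000 in
/-- **The chart-0 seam in the ring-brick `appLE` spelling** (res-L1-w45c-lead-1's
`coneBrick_zero_of_ringBrick₂` / `coneBrick_zero_of_ringBrick'` letters: `V := chart 0`, `hle`,
(i′) `(O₀.ι)^*((π^* f)|_{chart 0}) = Ω (f/1)`). [OURS · L1 W4.5c] [folklore; assembly of landed
decls] -/
theorem exists_sectionsEquiv_chart0_appLE
    (hI : ∀ g : ↥(Subgroup.zpowers σ), g • I12 k n a b c d = I12 k n a b c d)
    (ρ : ↥(Subgroup.zpowers σ) →* Aut (Spec (CommRingCat.of (MvPolynomial (Fin n) k))))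
    (hρ : ∀ g : ↥(Subgroup.zpowers σ), (ρ g).hom = Spec.map (CommRingCat.ofHom
      ((MulSemiringAction.toRingEquiv (↥(Subgroup.zpowers σ)) (MvPolynomial (Fin n) k) g⁻¹ :
        MvPolynomial (Fin n) k ≃+* MvPolynomial (Fin n) k) :
          MvPolynomial (Fin n) k →+* MvPolynomial (Fin n) k)))
    (hJρ : ∀ g : ↥(Subgroup.zpowers σ),
      (affineBlowup.idealSheaf (I12 k n a b c d)).comap (ρ g).hom =
        affineBlowup.idealSheaf (I12 k n a b c d))
    (ρB : ActionOver (affineBlowup.π (I12 k n a b c d) ≫ qσ) ↥(Subgroup.zpowers σ))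
    (haut : ρB.aut = (affineBlowup.isBlowup (I12 k n a b c d)).liftAction ρ hJρ)
    (O₀ : ρB.StableAffineOpens) (hO₀ : O₀.1 = chart k n a b c d 0)
    (hle : ((O₀.1.ι ≫ affineBlowup.π (I12 k n a b c d) ≫ qσ) ⁻¹ᵁ ⊤ : (O₀.1 : Scheme.{0}).Opens) ≤
      O₀.1.ι ⁻¹ᵁ chart k n a b c d 0) :
    ∃ (φ : ↥(Subgroup.zpowers σ) → (reesGrading (I12 k n a b c d) →+*ᵍ reesGrading (I12 k n a b c d)))
      (hP : ∀ g, Submonoid.powers (reesT (gens12 k n a b c d 0) (gens12_mem_I12 k n a b c d 0)) ≤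
        (Submonoid.powers (reesT (gens12 k n a b c d 0) (gens12_mem_I12 k n a b c d 0))).comap (φ g))
      (Ω : HomogeneousLocalization.Away (reesGrading (I12 k n a b c d))
          (reesT (gens12 k n a b c d 0) (gens12_mem_I12 k n a b c d 0)) ≃+*
        Γ((O₀.1 : Scheme.{0}), (O₀.1.ι ≫ affineBlowup.π (I12 k n a b c d) ≫ qσ) ⁻¹ᵁ ⊤)),
      (∀ (g : ↥(Subgroup.zpowers σ)) x, ((φ g x : reesAlgebra (I12 k n a b c d)) :
          (MvPolynomial (Fin n) k)[X]) =
        (x : (MvPolynomial (Fin n) k)[X]).map ((MulSemiringAction.toRingEquiv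
          (↥(Subgroup.zpowers σ)) (MvPolynomial (Fin n) k) g⁻¹ : _ ≃+* _) : _ →+* _)) ∧
      (∀ f : MvPolynomial (Fin n) k,
        O₀.1.ι.appLE (chart k n a b c d 0)
          ((O₀.1.ι ≫ affineBlowup.π (I12 k n a b c d) ≫ qσ) ⁻¹ᵁ ⊤) hle
          ((affineBlowup.π (I12 k n a b c d)).appLE ⊤ (chart k n a b c d 0)
            (blowupChart_le_preimage _ _ _ _) (ι₀ f)) =
        Ω (((fromZeroRingHom (reesGrading (I12 k n a b c d)) (.powers _)).comp
          (reesGrading.zeroRingHom (I12 k n a b c d))) f)) ∧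
      (∀ (g : ↥(Subgroup.zpowers σ)) y, (ρB.restrict O₀.1 O₀.2.1).act g ⊤ (Ω y) =
        Ω (HomogeneousLocalization.map (φ g⁻¹) (hP g⁻¹) y)) ∧
      (∀ y, Ω y ∈ (ρB.restrict O₀.1 O₀.2.1).invariantsRing ⊤ ↔
        ∀ g, HomogeneousLocalization.map (φ g) (hP g) y = y) := by
  have H := exists_sectionsEquiv_chart0 k n σ a b c d e hab hac had hae hσ hI ρ hρ hJρ ρB haut O₀ hO₀
  rcases H with ⟨φ, hP, Ω, hφ, hΩi, hΩii, hΩiii⟩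
  refine ⟨φ, hP, Ω, hφ, fun f => ?_, hΩii, hΩiii⟩
  -- (i') from (i) by composing the two `appLE`s
  rw [← CommRingCat.comp_apply, Scheme.Hom.appLE_comp_appLE]
  exact (hΩi f).symm

end JordanFive

end Summit.ResolutionOfSingularities.ResolutionOfSingularities.Theorems.WildQuotientResolution

end
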